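import Literature.IUT.HodgeArakelov.LabelClassesOfCuspsCor24iGraphLevelsOfSpecialFibre
import Literature.IUT.HodgeArakelov.LabelClassesOfCuspsCor24iGenuine
import Literature.IUT.HodgeArakelov.PlusMinusTowerCoverModelTempered
import HarnessLib

/-!
# [IUTchII] Cor 2.4 (i)′ AT THE GENUINE PAIR with input (B) over an admissible tower of `X̲_v`'s special-fibre datum

S. Mochizuki, *Inter-universal Teichmüller Theory II*, kurims manuscript (Dec. 2020), §2, Cor 2.4 (i) pp. 69–71, proof p. 70 l. −5 – p. 71
l. 5; *… I* (May 2020), §2, Cor 2.3 (v)/(vi) pp. 47–48, Prop 2.4 (i) p. 50 [cite: Mochizuki2012, II Cor 2.4 (i) pp.69–71] (D-0012 claim key,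
status DISPUTED: every [IUTchI]/[IUTchII]/[SemiAnbd] statement below is a HYPOTHESIS named by the tree's typed predicates or a kernel theorem about
the tree's own constructions; nothing printed is asserted).

abc-iut cell, node **IUTchII:Cor2.4(i)** (CONE-BOARD claimant abc-iut-w4-d012; gen 6), GAP-LEDGER G-w4d012-1 (closed in kernel, parts 1–2) and
**G-w4d012-2** (the open-subgroup step (B), here REDUCED at the genuine pair).  PROOF-ONLY (no `def`/`instance`/`structure`).  The assembly of
part 2 (`exists_stableCurveAgreement_ofPiCHat_ofSpecialFibre_isHomeomorph`, p437345), part 3 (`piPM_inf_hat_le_piV_ofPiCHat`: «`Π^±_v ∩ Π̂_v ⊆ Π_v`»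
at the tower of record, p438582) and part 4 (`cor24_i_ofSpecialFibre_graphTower`: (A)+(B)+(C) at an agreement with a special-fibre datum, (B)
over an ADMISSIBLE tower with abc-iut-w5-d121's Def 2.3 (ii)′ relaxed to its conjunct 2):

* **`cor24_i'_ofPiCHat_of_graphTower`** — at abc-iut-L6-t19's tower of record `ofPiCHat` and abc-iut-L5's datum `ofSpecialFibre` of the curve
  `X̲_v` (B15), there are the transported cuspidal datum `Cu` and a BICONTINUOUS agreement `A` (`eHat ∘ emb = ιX ∘ plainIso`, level clause) such
  that the decl of record `Cor24_i' Dec (ofPiCHat …) Cu Ld I` HOLDS for every `Π_v`-cuspidal `I ⊆ Δ̂^cor_v` MODULO ONLY: [IUTchI] Prop 2.4 (i)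
  of `X̲_v`'s datum (L5 node IUTchI:Prop2.4(i)); and, per admissible `Π_{v□}`, a sub-graph `Π^tp_{ℍ'}` of the special fibre of `X̲_v`
  (`Π̂_{ℍ'}` its closure) with the Δ-dictionary identity through `A.eHat` («`ℍ' = Γ_□`»), [IUTchI] Cor 2.3 (v) of its datum (L5 node), an
  ADMISSIBLE tower of that datum (levels `ρ̂⁻¹(V_i)`, `V_i ⊴ Π̂_𝔾` open, shrinking to `1`) realised by coverings of semi-graphs (abc-iut-w4-d076
  `CoveringLevelGraphs`) whose level data satisfy [IUTchI] Cor 2.3 (vi) BY NAME (L5 node, plan/L5/SUBDAG-IUTchI-Cor23Levels.md), the (D3)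
  stabiliser statement ([SemiAnbd] Cor 2.7 (i) proof; abc-iut-L3 rows D3/D3b) and «levels below `Π̂_v`».
  EVERY tower-side input — the agreement, bicontinuity, `[Π^±_v : Π_v] = l`, hΛ, conjunct 2 of Def 2.3 (ii)′, `Π^±_v ∩ Π̂_v ⊆ Π_v`, Cor 2.3
  (ii), density and closedness of `Π̂_{ℍ'}` — is DISCHARGED; the binders left are `hZ`, `hN`, `hDopen` and the special-fibre DATA of `X̲_v`.

HONEST LABEL: genuine on both sides modulo those binders; the per-`□` residual is a list of NAMED L3/L5 statements about the special fibre of `X̲_v`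
plus the Δ-dictionary identity that names `□ ↔ ℍ'`.  Typed ≠ proved for them; nothing here takes a side on [IUTchIII] Cor 3.12 or asserts
anything of the series.
-/

noncomputable section

namespace Literature.IUT.HodgeArakelov

open Literature.AnabelianGeometry.EtaleTheta Literature.AnabelianGeometry.SemiGraphs Literature.IUT.HodgeTheaters
open _root_.Topology
open scoped Pointwise

namespace PlusMinusTower

variable {p : ℕ} [Fact p.Prime] {M : MuTwoSetting p} (e : M.CLevelData)
  {E : M.toThetaSetting.EtaleThetaData} {l : ℕ} (C : E.DoubleUnderline l) {N : ℕ+}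
  (μ : M.toThetaSetting.CyclotomeMod l N) (hC : M.toThetaSetting.Compat) (hS : M.toThetaSetting.Sec2Hyps)
  (hl : l.Prime) (hp2 : p ≠ 2) (hpl : p ≠ l) (hζ : ∃ ζ : M.toThetaSetting.K, IsPrimitiveRoot ζ (4 * l))
  {η : (C.thetaEnvData μ hC hS).PiYdd → MuN p N} (hη : η ∈ (C.thetaEnvData μ hC hS).thetaCocycles)
  (hZ : Thm16Sub.KerToZIsCompactlyGenerated M.toThetaSetting) (hN : (C.Huu.subgroupOf (M.GtpXu l)).Normal)
  {P : TopGroup.{0}} (T : TemperedCoverings (BadPlaceSetting.ofUnderline C μ hC hS hl hp2 hpl hζ hη) P)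

/-- **[IUTchII] Cor 2.4 (i)′ AT THE GENUINE PAIR, input (B) over an admissible tower** (kurims pp. 69–71): see the module docstring — the decl
of record `Cor24_i' Dec (ofPiCHat …) Cu Ld I` at abc-iut-L6-t19's tower of record for every `Π_v`-cuspidal `I ⊆ Δ̂^cor_v`, MODULO ONLY [IUTchI]
Prop 2.4 (i) of `X̲_v`'s datum and, per admissible `□`, NAMED L3/L5 data of the sub-graph datum `ℍ'` of `X̲_v`'s special fibre (Δ-dictionary,
Cor 2.3 (v), admissible tower realised by coverings of semi-graphs with Cor 2.3 (vi) by name, (D3) stabilisers, levels below `Π̂_v`); every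
tower-side input DISCHARGED (parts 1–4).  PROVED. ([IUTchII] Cor 2.4 (i), kurims pp.69–71) [claim: Mochizuki2012, status: disputed] -/
theorem cor24_i'_ofPiCHat_of_graphTower [(M.GtpXu l).FiniteIndex] [FiniteDimensional ℚ_[p] M.K]
    (hDopen : ∀ (x : M.toTemperedCurve.Pt) (g : M.toTemperedCurve.PiTemp),
      IsOpen (M.toTemperedCurve.aug '' ((M.toTemperedCurve.decompOfOpenAt (M.GtpXu l) x g).map (M.GtpXu l).subtype :
        Set M.toTemperedCurve.PiTemp)))
    (d : (M.toTemperedCurve.ofOpenSubgroup (M.GtpXu l) (M.toThetaSetting.isOpen_GtpXu l) M.K (range_aug_GtpXu_eq_GK C) hDopen).GroupLevelData)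
    (Sf : SpecialFibreData ((M.toTemperedCurve.ofOpenSubgroup (M.GtpXu l) (M.toThetaSetting.isOpen_GtpXu l) M.K (range_aug_GtpXu_eq_GK C) hDopen).toTemperedArithmeticGroup d))
    (h36 : Sf.Gc.Prop36Hypotheses) (Sigma SigmaHat : Set ℕ) (hsub : Sigma ⊆ SigmaHat) (hne : Sigma.Nonempty)
    (hprime : ∀ q ∈ SigmaHat, q.Prime) (hp : p ∉ Sigma) (TpH : Subgroup Sf.chart.G)
    (HatH : Subgroup (TemperedGraphGroupData.exists_completion_of_prop36 Sf.Gc h36 Sf.chart).choose)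
    (hle : TpH.map (TemperedGraphGroupData.exists_completion_of_prop36 Sf.Gc h36 Sf.chart).choose_spec.choose.toMonoidHom ≤ HatH)
    (cuspMeetsH : {x : (M.toTemperedCurve.ofOpenSubgroup (M.GtpXu l) (M.toThetaSetting.isOpen_GtpXu l) M.K (range_aug_GtpXu_eq_GK C) hDopen).Pt // (M.toTemperedCurve.ofOpenSubgroup (M.GtpXu l) (M.toThetaSetting.isOpen_GtpXu l) M.K (range_aug_GtpXu_eq_GK C) hDopen).IsCusp x} → Prop)
    {D : EtaleThetaData (BadPlaceSetting.ofUnderline C μ hC hS hl hp2 hpl hζ hη).toThetaSetting P}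
    (Dec : SubgraphDecomposition (BadPlaceSetting.ofUnderline C μ hC hS hl hp2 hpl hζ hη) T D) :
    ∃ (Cu : CuspidalInertiaData (ofPiCHat e C μ hC hS hl hp2 hpl hζ hη hZ hN T))
      (A : StableCurveAgreement (ofPiCHat e C μ hC hS hl hp2 hpl hζ hη hZ hN T) Cu
        (StableCurveTemperedData.ofSpecialFibre (M.toTemperedCurve.ofOpenSubgroup (M.GtpXu l) (M.toThetaSetting.isOpen_GtpXu l) M.K (range_aug_GtpXu_eq_GK C) hDopen) d Sf h36 Sigma SigmaHat hsub hne hprime hp TpH HatH hle cuspMeetsH)),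
      IsHomeomorph A.eHat ∧
      (∀ x : T.Xplain,
        A.eHat ⟨(ofPiCHat e C μ hC hS hl hp2 hpl hζ hη hZ hN T).emb x, (ofPiCHat e C μ hC hS hl hp2 hpl hζ hη hZ hN T).emb_le_pmHat ⟨x, rfl⟩⟩ =
          (StableCurveTemperedData.ofSpecialFibre (M.toTemperedCurve.ofOpenSubgroup (M.GtpXu l) (M.toThetaSetting.isOpen_GtpXu l) M.K (range_aug_GtpXu_eq_GK C) hDopen) d Sf h36 Sigma SigmaHat hsub hne hprime hp TpH HatH hle cuspMeetsH).ιX (T.plainIso x)) ∧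
      (∀ (Q I : Subgroup (ofPiCHat e C μ hC hS hl hp2 hpl hζ hη hZ hN T).Corhat), Cu.IsCuspidalInertia Q I ↔
        I ≤ Q ∧ ∃ I₀, Cu.IsCuspidalInertia (ofPiCHat e C μ hC hS hl hp2 hpl hζ hη hZ hN T).piPM I₀ ∧ I = I₀ ⊓ Q) ∧
      ∀ {L : LabCuspStructure Cu} (Ld : LabelledDecomposition Dec L),
        (StableCurveTemperedData.ofSpecialFibre (M.toTemperedCurve.ofOpenSubgroup (M.GtpXu l) (M.toThetaSetting.isOpen_GtpXu l) M.K (range_aug_GtpXu_eq_GK C) hDopen) d Sf h36 Sigma SigmaHat hsub hne hprime hp TpH HatH hle cuspMeetsH).Prop24i →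
        ∀ {I : Subgroup (ofPiCHat e C μ hC hS hl hp2 hpl hζ hη hZ hN T).Corhat},
          (∀ H : Subgroup P, Cor24_family Dec Ld H →
            ∃ (TpH' : Subgroup Sf.chart.G) (HatH' : Subgroup (TemperedGraphGroupData.exists_completion_of_prop36 Sf.Gc h36 Sf.chart).choose)
              (hle' : TpH'.map (TemperedGraphGroupData.exists_completion_of_prop36 Sf.Gc h36 Sf.chart).choose_spec.choose.toMonoidHom ≤ HatH')
              (cMH' : {x : (M.toTemperedCurve.ofOpenSubgroup (M.GtpXu l) (M.toThetaSetting.isOpen_GtpXu l) M.K (range_aug_GtpXu_eq_GK C) hDopen).Pt // (M.toTemperedCurve.ofOpenSubgroup (M.GtpXu l) (M.toThetaSetting.isOpen_GtpXu l) M.K (range_aug_GtpXu_eq_GK C) hDopen).IsCusp x} → Prop)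
              (_ : ((StableCurveTemperedData.ofSpecialFibre (M.toTemperedCurve.ofOpenSubgroup (M.GtpXu l) (M.toThetaSetting.isOpen_GtpXu l) M.K (range_aug_GtpXu_eq_GK C) hDopen) d Sf h36 Sigma SigmaHat hsub hne hprime hp TpH' HatH' hle' cMH').graph.HatH :
                  Set (StableCurveTemperedData.ofSpecialFibre (M.toTemperedCurve.ofOpenSubgroup (M.GtpXu l) (M.toThetaSetting.isOpen_GtpXu l) M.K (range_aug_GtpXu_eq_GK C) hDopen) d Sf h36 Sigma SigmaHat hsub hne hprime hp TpH' HatH' hle' cMH').graph.Hat) =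
                closure ((StableCurveTemperedData.ofSpecialFibre (M.toTemperedCurve.ofOpenSubgroup (M.GtpXu l) (M.toThetaSetting.isOpen_GtpXu l) M.K (range_aug_GtpXu_eq_GK C) hDopen) d Sf h36 Sigma SigmaHat hsub hne hprime hp TpH' HatH' hle' cMH').graph.ι ''
                  (StableCurveTemperedData.ofSpecialFibre (M.toTemperedCurve.ofOpenSubgroup (M.GtpXu l) (M.toThetaSetting.isOpen_GtpXu l) M.K (range_aug_GtpXu_eq_GK C) hDopen) d Sf h36 Sigma SigmaHat hsub hne hprime hp TpH' HatH' hle' cMH').graph.TpH))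
              (_ : (((ofPiCHat e C μ hC hS hl hp2 hpl hζ hη hZ hN T).deltaPmBox H).subgroupOf (ofPiCHat e C μ hC hS hl hp2 hpl hζ hη hZ hN T).pmHat).map A.eHat.toMonoidHom =
                ((StableCurveTemperedData.ofSpecialFibre (M.toTemperedCurve.ofOpenSubgroup (M.GtpXu l) (M.toThetaSetting.isOpen_GtpXu l) M.K (range_aug_GtpXu_eq_GK C) hDopen) d Sf h36 Sigma SigmaHat hsub hne hprime hp TpH' HatH' hle' cMH').deltaTpH.map
                  (StableCurveTemperedData.ofSpecialFibre (M.toTemperedCurve.ofOpenSubgroup (M.GtpXu l) (M.toThetaSetting.isOpen_GtpXu l) M.K (range_aug_GtpXu_eq_GK C) hDopen) d Sf h36 Sigma SigmaHat hsub hne hprime hp TpH' HatH' hle' cMH').ιΔ).map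
                  (StableCurveTemperedData.ofSpecialFibre (M.toTemperedCurve.ofOpenSubgroup (M.GtpXu l) (M.toThetaSetting.isOpen_GtpXu l) M.K (range_aug_GtpXu_eq_GK C) hDopen) d Sf h36 Sigma SigmaHat hsub hne hprime hp TpH' HatH' hle' cMH').DeltaHat.subtype)
              (_ : (StableCurveTemperedData.ofSpecialFibre (M.toTemperedCurve.ofOpenSubgroup (M.GtpXu l) (M.toThetaSetting.isOpen_GtpXu l) M.K (range_aug_GtpXu_eq_GK C) hDopen) d Sf h36 Sigma SigmaHat hsub hne hprime hp TpH' HatH' hle' cMH').Cor23v)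
              (Tw : (StableCurveTemperedData.ofSpecialFibre (M.toTemperedCurve.ofOpenSubgroup (M.GtpXu l) (M.toThetaSetting.isOpen_GtpXu l) M.K (range_aug_GtpXu_eq_GK C) hDopen) d Sf h36 Sigma SigmaHat hsub hne hprime hp TpH' HatH' hle' cMH').Prop24Tower)
              (V : Tw.I → Subgroup (StableCurveTemperedData.ofSpecialFibre (M.toTemperedCurve.ofOpenSubgroup (M.GtpXu l) (M.toThetaSetting.isOpen_GtpXu l) M.K (range_aug_GtpXu_eq_GK C) hDopen) d Sf h36 Sigma SigmaHat hsub hne hprime hp TpH' HatH' hle' cMH').graph.Hat)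
              (_ : ∀ i (y : (StableCurveTemperedData.ofSpecialFibre (M.toTemperedCurve.ofOpenSubgroup (M.GtpXu l) (M.toThetaSetting.isOpen_GtpXu l) M.K (range_aug_GtpXu_eq_GK C) hDopen) d Sf h36 Sigma SigmaHat hsub hne hprime hp TpH' HatH' hle' cMH').DeltaHat),
                (y : (StableCurveTemperedData.ofSpecialFibre (M.toTemperedCurve.ofOpenSubgroup (M.GtpXu l) (M.toThetaSetting.isOpen_GtpXu l) M.K (range_aug_GtpXu_eq_GK C) hDopen) d Sf h36 Sigma SigmaHat hsub hne hprime hp TpH' HatH' hle' cMH').PiHat) ∈ Tw.Jhat i ↔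
                  (StableCurveTemperedData.ofSpecialFibre (M.toTemperedCurve.ofOpenSubgroup (M.GtpXu l) (M.toThetaSetting.isOpen_GtpXu l) M.K (range_aug_GtpXu_eq_GK C) hDopen) d Sf h36 Sigma SigmaHat hsub hne hprime hp TpH' HatH' hle' cMH').ρHat y ∈ V i)
              (_ : ∀ i, (V i).Normal) (_ : ∀ i, IsOpen (V i : Set (StableCurveTemperedData.ofSpecialFibre (M.toTemperedCurve.ofOpenSubgroup (M.GtpXu l) (M.toThetaSetting.isOpen_GtpXu l) M.K (range_aug_GtpXu_eq_GK C) hDopen) d Sf h36 Sigma SigmaHat hsub hne hprime hp TpH' HatH' hle' cMH').graph.Hat))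
              (_ : ∀ O ∈ 𝓝 (1 : (StableCurveTemperedData.ofSpecialFibre (M.toTemperedCurve.ofOpenSubgroup (M.GtpXu l) (M.toThetaSetting.isOpen_GtpXu l) M.K (range_aug_GtpXu_eq_GK C) hDopen) d Sf h36 Sigma SigmaHat hsub hne hprime hp TpH' HatH' hle' cMH').graph.Hat), ∃ i, (V i : Set _) ⊆ O)
              (Cv : Tw.CoveringLevelGraphs) (Ad : ∀ i, Cv.toLevelData.LevelDatum i),
              (∀ i, (Ad i).lev.Cor23vi) ∧
              (∀ i (γ : (StableCurveTemperedData.ofSpecialFibre (M.toTemperedCurve.ofOpenSubgroup (M.GtpXu l) (M.toThetaSetting.isOpen_GtpXu l) M.K (range_aug_GtpXu_eq_GK C) hDopen) d Sf h36 Sigma SigmaHat hsub hne hprime hp TpH' HatH' hle' cMH').DeltaTp),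
                (∀ v ∈ Cv.toLevelData.compH i, Cv.toLevelData.act i
                  (γ : (StableCurveTemperedData.ofSpecialFibre (M.toTemperedCurve.ofOpenSubgroup (M.GtpXu l) (M.toThetaSetting.isOpen_GtpXu l) M.K (range_aug_GtpXu_eq_GK C) hDopen) d Sf h36 Sigma SigmaHat hsub hne hprime hp TpH' HatH' hle' cMH').PiTp) v ∈ Cv.toLevelData.compH i) →
                  ∃ ĥ ∈ (StableCurveTemperedData.ofSpecialFibre (M.toTemperedCurve.ofOpenSubgroup (M.GtpXu l) (M.toThetaSetting.isOpen_GtpXu l) M.K (range_aug_GtpXu_eq_GK C) hDopen) d Sf h36 Sigma SigmaHat hsub hne hprime hp TpH' HatH' hle' cMH').graph.HatH,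
                    ĥ⁻¹ * (StableCurveTemperedData.ofSpecialFibre (M.toTemperedCurve.ofOpenSubgroup (M.GtpXu l) (M.toThetaSetting.isOpen_GtpXu l) M.K (range_aug_GtpXu_eq_GK C) hDopen) d Sf h36 Sigma SigmaHat hsub hne hprime hp TpH' HatH' hle' cMH').graph.ι
                      ((StableCurveTemperedData.ofSpecialFibre (M.toTemperedCurve.ofOpenSubgroup (M.GtpXu l) (M.toThetaSetting.isOpen_GtpXu l) M.K (range_aug_GtpXu_eq_GK C) hDopen) d Sf h36 Sigma SigmaHat hsub hne hprime hp TpH' HatH' hle' cMH').ρTp γ) ∈ V i) ∧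
              (∀ i, Tw.Jhat i ≤ ((ofPiCHat e C μ hC hS hl hp2 hpl hζ hη hZ hN T).hat.subgroupOf (ofPiCHat e C μ hC hS hl hp2 hpl hζ hη hZ hN T).pmHat).map A.eHat.toMonoidHom)) →
          Literature.IUT.HodgeArakelov.Cor24_i' Dec (ofPiCHat e C μ hC hS hl hp2 hpl hζ hη hZ hN T) Cu Ld I := by
  obtain ⟨Cu, A, hhomeo, hA, hlev⟩ := exists_stableCurveAgreement_ofPiCHat_ofSpecialFibre_isHomeomorph e C μ hC hS hl hp2 hpl hζ hη hZ hN T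
    hDopen d Sf h36 Sigma SigmaHat hsub hne hprime hp TpH HatH hle cuspMeetsH
  refine ⟨Cu, A, hhomeo, hA, hlev, fun Ld h24i I GraphTower H hH => ?_⟩
  obtain ⟨TpH', HatH', hle', cMH', hH', hDic, h23v', Tw, V, hJhat, hVn, hVo, hV, Cv, Ad, h23vi, hst, hlevV⟩ := GraphTower H hH
  exact A.cor24_i_ofSpecialFibre_graphTower (index_piV_subgroupOf_piPM_ofUnderline_ne_zero C μ hC hS hl hp2 hpl hζ hη T _) hlev
    (piPM_inf_hat_le_piV_ofPiCHat e C μ hC hS hl hp2 hpl hζ hη hZ hN T).2 hhomeo h24i I TpH' HatH' hle' cMH' hH' hDic h23v' Tw V hJhat hVn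
    hVo hV Cv Ad h23vi hst hlevV

end PlusMinusTower

end Literature.IUT.HodgeArakelov

end
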